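import Summits.QuantumFields.BalabanUV.Beta.AxialCoordinateProjectorCoarseRules
import Summits.QuantumFields.BalabanUV.Beta.RelInvFactorSandwich
import Summits.QuantumFields.BalabanUV.Beta.SymmetrisedDressingReflection
import Summits.QuantumFields.BalabanUV.Beta.AxialDressingRootedReflection
import Summits.QuantumFields.BalabanUV.Beta.RelInvBorderedHessian

/-!
# `BalabanUV.Beta.CombChartResolventRules` — binder row D1, RULING R-D1-g35-1 (repair route (β) = CHART (III′)): THE COMB-CHART RESOLVENT
# `G′_j := coDressKAt (ctr (d+1) Lc) Lc (Gsym Lc j)` — ITS FOUR STRUCTURAL LETTERS (DG′)(Spr)(TG′)(RG′), THE COARSE-RESTRICTED ROOTED PROJECTOR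
# KERNEL `piKC`, AND RULES 1–2 OF `RelInv G′_j 𝕄 (axEc (ctr (d+1) Lc) Lc)` FOR ANY `𝕄` (pattern `AxialCoordinateProjectorCoarseRules` §4 verbatim with
# `piKBm ↦ piK`, `pmBm ↦ pm`; `comp_axE_trK_piK`'s mechanism `pm_eq_zero_of_isCombBond`; `Gsym_inr_row∕col_coarse` BY NAME)

HONEST FRAMING (cell contract, verbatim): «discharging `BetaPertH` makes Bałaban's UV stability UNCONDITIONAL — a real constructive-QFT
result; it is NOT the continuum limit and NOT the Clay problem.»  HONEST DEPENDENCY: continuum YM on T⁴ ⇐ BetaPertH ∧ nine spine estimates (0/9 proved);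
BetaPertH ⇐ (D1) ∧ (D4) ∧ CAP+tail; G-an2-4 gates asym, D1 and NE2/3/4.
DERIVED cell leaf (β sub-cell, BINDER-OWNERS row D1 OWNER `b2b-balaban-beta-an2`, gen 35; bricks P1 + B3 of RULING R-D1-g35-1, memo
`HOME/b2b-balaban-beta-an2/gen35/R-D1-g35-1-CHART-IIIprime.v1.md`).  WHY.  Under R-D1-g35-1 the row's reflection-covariance binder hR is repaired in chart
(III′): an1's (0.4) tables and the (0.4)-symmetrised shifted spread `bhKStepSh d Lc (Dsh Lc) j` UNCHANGED, read in the ROOTED COMB slice `axEc ρ_c Lc` with the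
rooted comb dressing `piK ρ_c Lc` and the resolvent `G′_j := coDressKAt ρ_c Lc (Gsym Lc j)` (an3's XAN262-AN3 §1).  This file supplies the parts of that
programme that are bookkeeping over landed lemmas: §1 the four letters every END consumes as `hKd`∕`hKs`∕`hGr`-shaped binders; §2 the rooted twin `piKC`
of `piKBmC` (multiplier identity restricted to the coarse sublattice) with `axEc ∘ Πᵀ_ρ = (piKC)ᵀ`, `Πᵀ_ρ ∘ axEc = piKC` and the two substitution lemmas;
§3 RULES 1–2 `axEc ∘ G = G = G ∘ axEc` for `G := coDressKAt (toSite r) N K`, `K` spread with multiplier legs supported on the coarse sites, and the instance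
`G′_j`; §4 the IDENTITY pair `axEc ∘ piK = axEc = trK piK ∘ axEc` (K5 of an3 g78's P2 script, W-an3-g78-1: the coarse comb slice is FIXED by the rooted
dressing; rooted twin of `RelInvBorderedHessian.comp_axEc_piKBmC`, via the `ℤ`-valued `axialGaugeAt_bondInd_of_not_isCombBond` ∕ `pm_of_not_isCombBond`).
NOT HERE: rules 3–4 (brick P2 `RelInv G′_j (bhKStepSh d Lc (Dsh Lc) j) (axEc ρ_c Lc)`, OPEN; its crux B1 = blindness of the shifted spread to the
rooted dressing).  No statement of Bałaban's papers, no `[cite:]`, no `Prop` fact; ONE bookkeeping data def `piKC` ([our object — a kernel, asserting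
nothing], the decl-by-decl twin of `AxialDressingRooted.piKBmC`).  Discharges NO binder of the row; root-level classes 0∕5; the RECORD stays ROOT M′ p303989
(chart (II)); NOT D1, NOT `BetaPertH`, NOT continuum, NOT Clay.
Provenance: β sub-cell, unit beta-an2 gen 35, 2026-08-21 (v1; v1.1 = + §4); over `AxialCoordinateProjectorCoarse(Rules)` (an2 gen 13), `AxialDressingRooted{Kernel,
Linear,Reflection,Support}`, `RelInvBorderedHessian` §1, `SymmetrisedStepJets`, `RelInvFactorSandwich`, `SymmetrisedDressingReflection` BY NAME; no existing file touched.
-/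

noncomputable section

open Finset
open scoped BigOperators
open Literature.Probability.LatticeModels (TorusSite Torus.proj Torus.proj_apply)
open Literature.MathematicalPhysics.QuantumFieldTheory
open Literature.MathematicalPhysics.QuantumFieldTheory.Balaban1983to89
open Literature.MathematicalPhysics.QuantumFieldTheory.Balaban1983to89.Beta
open B12Sec2to5 (l1 l1_nonneg)
open ExpKernelCalculus (MKer Decays comp shiftK)
open KernelReflection (refK)
open ResolventReflection (Φ)
open AffineAveraging (box toSite)
open AveragingContoursRooted (ctr ctrOff ctrOff_mem_box AxialGaugeAt)
open RootedComb (axProjAt_eq_self_of_axialGaugeAt)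
open OneStepResolventKernel (Fib)
open OneStepKernelFamily (KInvStep)
open Summit.QuantumFields.BalabanUV.Beta.TameKernelCalculus
open Summit.QuantumFields.BalabanUV.Beta.AxialDressingRooted
open Summit.QuantumFields.BalabanUV.Beta.BorderedHessian (isCombBondAt_of_mem_axial)
open Summit.QuantumFields.BalabanUV.Beta.SymmetrisedStepJets (Gsym decays_Gsym shiftK_Gsym)
open Summit.QuantumFields.BalabanUV.Beta.RelInvFactorSandwich (spr_Gsym Gsym_inr_row_coarse Gsym_inr_col_coarse)
open Summit.QuantumFields.BalabanUV.Beta.SymmetrisedDressingReflection (refK_coDressKSymAt_KInvStep)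

namespace Summit.QuantumFields.BalabanUV.Beta.CombChartResolventRules

variable {d : ℕ}

/-! ## §1 The comb-chart resolvent `G′_j := coDressKAt ρ_c Lc (Gsym Lc j)` and its four structural letters -/

section Letters

variable (Lc : ℕ) [NeZero Lc]

/-- [folklore] (DG′) **the comb-chart resolvent decays**: `∃ δ C, 0 < δ ∧ 0 ≤ C ∧ Decays G′_j C δ` (`decays_coDressKAt` + `decays_Gsym`). -/
theorem decays_coDressKAt_Gsym (j : ℕ) :
    ∃ δ C : ℝ, 0 < δ ∧ 0 ≤ C ∧ Decays (coDressKAt (ctr (d + 1) Lc) Lc (Gsym (d := d) Lc j)) C δ :=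
  decays_coDressKAt (one_le_of_neZero Lc) (ctrOff_mem_box (one_le_of_neZero Lc)) (decays_Gsym Lc j)

/-- [folklore] (Spr) the comb-chart resolvent is spread (`spr_coDressKAt` + `spr_Gsym`). -/
theorem spr_coDressKAt_Gsym (j : ℕ) : Spr (coDressKAt (ctr (d + 1) Lc) Lc (Gsym (d := d) Lc j)) :=
  spr_coDressKAt (one_le_of_neZero Lc) (ctrOff_mem_box (one_le_of_neZero Lc)) (spr_Gsym j)

/-- [folklore] (TG′) **block-translation invariance**: `shiftK (−(Lc•t)) G′_j = G′_j` (`shiftK_coDressKAt` + `shiftK_Gsym`). -/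
theorem shiftK_coDressKAt_Gsym (j : ℕ) (t : Fin (d + 1) → ℤ) :
    shiftK (-((Lc : ℤ) • t)) (coDressKAt (ctr (d + 1) Lc) Lc (Gsym (d := d) Lc j)) = coDressKAt (ctr (d + 1) Lc) Lc (Gsym (d := d) Lc j) :=
  shiftK_coDressKAt _ (one_le_of_neZero Lc) (shiftK_Gsym Lc j) t

variable {Lc}

/-- [folklore] (RG′) **axis-reflection invariance at the centred root**, `Lc` odd: `refK (Φ Lc α) G′_j = G′_j` (`refK_coDressKAt` over
`refK_coDressKSymAt_KInvStep`; `ctr = toSite ∘ ctrOff` by `rfl`). -/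
theorem refK_coDressKAt_Gsym (hLc : Odd Lc) (j : ℕ) (α : Fin (d + 1)) :
    refK (Φ Lc α) (coDressKAt (ctr (d + 1) Lc) Lc (Gsym (d := d) Lc j)) = coDressKAt (ctr (d + 1) Lc) Lc (Gsym (d := d) Lc j) :=
  refK_coDressKAt hLc (spr_Gsym j) α (refK_coDressKSymAt_KInvStep hLc j α)

end Letters

/-! ## §2 The coarse-restricted rooted projector kernel `piKC` and its algebra with `axEc` -/

section PiKC

/-- [our object — a kernel, asserting nothing] **`piK` WITH THE MULTIPLIER IDENTITY RESTRICTED TO THE COARSE SITES** (the rooted twin of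
`AxialDressingRooted.piKBmC`): `Πᵀ_ρ` on the field block, `[proj N x = 0]·δ` on the multiplier block, mixed blocks zero. -/
def piKC (ρ : Fin (d + 1) → ℤ) (N : ℕ) : MKer (d + 1) (Fib d) :=
  fun x x' a b =>
    match a, b with
    | Sum.inl α, Sum.inl β => piK ρ N x x' (Sum.inl α) (Sum.inl β)
    | Sum.inl _, Sum.inr _ => 0
    | Sum.inr _, Sum.inl _ => 0
    | Sum.inr m, Sum.inr m' => if x = x' ∧ m = m' ∧ Torus.proj N x = 0 then 1 else 0

variable (ρ : Fin (d + 1) → ℤ) (N : ℕ)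

/-- [folklore] Field–field entry of `piKC` is that of `piK`. -/
theorem piKC_inl_inl (x x' : Fin (d + 1) → ℤ) (α β : Fin (d + 1)) :
    piKC ρ N x x' (Sum.inl α) (Sum.inl β) = piK ρ N x x' (Sum.inl α) (Sum.inl β) := rfl

/-- [folklore] Field–multiplier entry of `piKC` vanishes. -/
theorem piKC_inl_inr (x x' : Fin (d + 1) → ℤ) (α m : Fin (d + 1)) : piKC ρ N x x' (Sum.inl α) (Sum.inr m) = 0 := rfl

/-- [folklore] Multiplier–field entry of `piKC` vanishes. -/
theorem piKC_inr_inl (x x' : Fin (d + 1) → ℤ) (m α : Fin (d + 1)) : piKC ρ N x x' (Sum.inr m) (Sum.inl α) = 0 := rfl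

/-- [folklore] Multiplier–multiplier entry of `piKC`: the coarse diagonal indicator. -/
theorem piKC_inr_inr (x x' : Fin (d + 1) → ℤ) (m m' : Fin (d + 1)) :
    piKC ρ N x x' (Sum.inr m) (Sum.inr m') = if x = x' ∧ m = m' ∧ Torus.proj N x = 0 then 1 else 0 := rfl

/-- [folklore] `piKC` decays at every rate with the constant of `piK` (in-block root). -/
theorem decays_piKC {N : ℕ} (hN : 1 ≤ N) {r : Fin (d + 1) → ℕ} (hr : r ∈ box (d + 1) N) {δ : ℝ} (hδ : 0 ≤ δ) :
    Decays (piKC (toSite r) N) (cP d N δ) δ := by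
  intro x x' a b
  have h := decays_piK hN hr hδ x x' a b
  have hpos : 0 ≤ cP d N δ * Real.exp (-δ * l1 (x - x')) := mul_nonneg (cP_nonneg d N δ) (Real.exp_pos _).le
  rcases a with α | m <;> rcases b with β | m'
  · rw [piKC_inl_inl]; exact h
  · rw [piKC_inl_inr, abs_zero]; exact hpos
  · rw [piKC_inr_inl, abs_zero]; exact hpos
  · rw [piKC_inr_inr]
    rw [piK_inr_inr] at h
    by_cases hx : x = x' ∧ m = m'
    · rw [if_pos hx] at h
      split_ifs
      · exact h
      · rw [abs_zero]; exact hpos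
    · rw [if_neg (fun h' => hx ⟨h'.1, h'.2.1⟩), abs_zero]; exact hpos

/-- [folklore] `piKC` is spread (in-block root). -/
theorem spr_piKC {N : ℕ} (hN : 1 ≤ N) {r : Fin (d + 1) → ℕ} (hr : r ∈ box (d + 1) N) : Spr (piKC (toSite r) N) :=
  ⟨cP d N 1, 1, one_pos, decays_piKC hN hr zero_le_one⟩

/-- [folklore] **`axEc ∘ Πᵀ_ρ = (piKC)ᵀ`**: the rooted projector has no comb rows (`pm_eq_zero_of_isCombBond`), and the multiplier identity
gets restricted to the coarse sites. -/
theorem comp_axEc_trK_piK : comp (axEc ρ N) (trK (piK ρ N)) = trK (piKC ρ N) := by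
  funext x x' a b
  rw [comp_axEc_apply]
  rcases a with α | m
  · dsimp only
    rw [trK_apply, trK_apply]
    split_ifs with hc
    · rcases b with β | m'
      · rw [piKC_inl_inl, piK_inl_inl]
        split_ifs
        · rw [pm_eq_zero_of_isCombBond hc, Int.cast_zero]
        · rfl
      · rfl
    · rcases b with β | m' <;> rfl
  · dsimp only
    rw [trK_apply, trK_apply]
    rcases b with β | m'
    · rw [piK_inl_inr, piKC_inl_inr, ite_self]
    · rw [piK_inr_inr, piKC_inr_inr]
      by_cases h : x' = x ∧ m' = m
      · obtain ⟨rfl, rfl⟩ := h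
        simp
      · rw [if_neg h, ite_self, if_neg (fun h' => h ⟨h'.1, h'.2.1⟩)]

/-- [folklore] **`Πᵀ_ρ ∘ axEc = piKC`** on the other side (no comb columns; coarse restriction of the multiplier identity). -/
theorem comp_piK_axEc : comp (piK ρ N) (axEc ρ N) = piKC ρ N := by
  funext x x' a b
  rw [comp_axEc_apply']
  rcases b with β | m
  · dsimp only
    split_ifs with hc
    · rcases a with α | m'
      · rw [piKC_inl_inl, piK_inl_inl]
        split_ifs
        · rw [pm_eq_zero_of_isCombBond hc, Int.cast_zero]
        · rfl
      · rfl
    · rcases a with α | m' <;> rfl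
  · dsimp only
    rcases a with α | m'
    · rw [piK_inl_inr, piKC_inl_inr, ite_self]
    · rw [piK_inr_inr, piKC_inr_inr]
      by_cases h : x = x' ∧ m' = m
      · obtain ⟨rfl, rfl⟩ := h
        simp
      · rw [if_neg h, ite_self, if_neg (fun h' => h ⟨h'.1, h'.2.1⟩)]

/-- [folklore] Against a kernel whose multiplier ROWS vanish off the coarse sites, `(piKC)ᵀ` acts as `(piK)ᵀ`: the restriction is invisible
(termwise; no summability needed). -/
theorem comp_trK_piKC_eq {K : MKer (d + 1) (Fib d)} (hK : ∀ x, Torus.proj N x ≠ 0 → ∀ z m b, K x z (Sum.inr m) b = 0) :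
    comp (trK (piKC ρ N)) K = comp (trK (piK ρ N)) K := by
  funext x z a b
  unfold ExpKernelCalculus.comp
  refine tsum_congr fun y => Finset.sum_congr rfl fun f _ => ?_
  rcases a with α | m <;> rcases f with l | l
  · rfl
  · rfl
  · rfl
  · rw [trK_apply, trK_apply, piKC_inr_inr, piK_inr_inr]
    by_cases h : y = x ∧ l = m
    · obtain ⟨rfl, rfl⟩ := h
      by_cases hc : Torus.proj N y = 0
      · simp [hc]
      · rw [hK y hc]; simp
    · rw [if_neg h, if_neg (fun h' => h ⟨h'.1, h'.2.1⟩)]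

/-- [folklore] Against a kernel whose multiplier COLUMNS vanish off the coarse sites, `piKC` acts as `piK`. -/
theorem comp_piKC_eq {A : MKer (d + 1) (Fib d)} (hA : ∀ z, Torus.proj N z ≠ 0 → ∀ x a m, A x z a (Sum.inr m) = 0) :
    comp A (piKC ρ N) = comp A (piK ρ N) := by
  funext x z a b
  unfold ExpKernelCalculus.comp
  refine tsum_congr fun y => Finset.sum_congr rfl fun f _ => ?_
  rcases f with l | l <;> rcases b with β | m
  · rfl
  · rfl
  · rfl
  · rw [piKC_inr_inr, piK_inr_inr]
    by_cases h : y = z ∧ l = m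
    · obtain ⟨rfl, rfl⟩ := h
      by_cases hc : Torus.proj N y = 0
      · simp [hc]
      · rw [hA y hc]; simp
    · rw [if_neg h, if_neg (fun h' => h ⟨h'.1, h'.2.1⟩)]

end PiKC

/-! ## §3 Rules 1–2 of the relative inverse for the rooted co-dressed kernel against the COARSE slice -/

section Rules

/-- [folklore] **RULE 1: `axEc ∘ G = G`** for `G := coDressKAt (toSite r) N K`, `K` spread with multiplier ROWS vanishing off the coarse sites. -/
theorem comp_axEc_coDressKAt {N : ℕ} (hN : 1 ≤ N) {r : Fin (d + 1) → ℕ} (hr : r ∈ box (d + 1) N) {K : MKer (d + 1) (Fib d)}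
    (hK : Spr K) (hKr : ∀ x, Torus.proj N x ≠ 0 → ∀ z m b, K x z (Sum.inr m) b = 0) :
    comp (axEc (toSite r) N) (coDressKAt (toSite r) N K) = coDressKAt (toSite r) N K := by
  have sE : Spr (axEc (d := d) (toSite r) N) := spr_axEc _ _
  have sP : Spr (piK (d := d) (toSite r) N) := spr_piK hN hr
  have sPt : Spr (trK (piK (d := d) (toSite r) N)) := spr_trK_piK hN hr
  rw [coDressKAt_eq, comp_assoc_tame sE.tame (spr_comp sPt hK).tame sP.tame, comp_assoc_tame sE.tame sPt.tame hK.tame,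
    comp_axEc_trK_piK, comp_trK_piKC_eq _ _ hKr]

/-- [folklore] **RULE 2: `G ∘ axEc = G`** (multiplier COLUMNS of `K` vanishing off the coarse sites). -/
theorem comp_coDressKAt_axEc {N : ℕ} (hN : 1 ≤ N) {r : Fin (d + 1) → ℕ} (hr : r ∈ box (d + 1) N) {K : MKer (d + 1) (Fib d)}
    (hK : Spr K) (hKc : ∀ z, Torus.proj N z ≠ 0 → ∀ x a m, K x z a (Sum.inr m) = 0) :
    comp (coDressKAt (toSite r) N K) (axEc (toSite r) N) = coDressKAt (toSite r) N K := by
  have sE : Spr (axEc (d := d) (toSite r) N) := spr_axEc _ _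
  have sP : Spr (piK (d := d) (toSite r) N) := spr_piK hN hr
  have sPt : Spr (trK (piK (d := d) (toSite r) N)) := spr_trK_piK hN hr
  have hcol : ∀ z, Torus.proj N z ≠ 0 → ∀ x a m, comp (trK (piK (toSite r) N)) K x z a (Sum.inr m) = 0 :=
    fun z hz x a m => comp_inr_col_eq_zero _ _ (fun y f => hKc z hz y f m) x a
  rw [coDressKAt_eq, ← comp_assoc_tame (spr_comp sPt hK).tame sP.tame sE.tame, comp_piK_axEc, comp_piKC_eq _ _ hcol]

/-- [folklore] **RULES 1–2 FOR THE COMB-CHART RESOLVENT AGAINST THE COARSE SLICE**: `axEc ρ_c Lc ∘ G′_j = G′_j = G′_j ∘ axEc ρ_c Lc` for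
`G′_j := coDressKAt (ctr (d+1) Lc) Lc (Gsym Lc j)` — the first two conjuncts of `ChartConjugationRelative.RelInv G′_j 𝕄 (axEc (ctr (d+1) Lc) Lc)` for
ANY `𝕄`, every `j` (`Gsym`'s multiplier legs are coarse: `RelInvFactorSandwich.Gsym_inr_row_coarse` ∕ `Gsym_inr_col_coarse`).  Rules 3–4 = brick P2 (OPEN). -/
theorem axEc_rules_coDressKAt_Gsym {Lc : ℕ} [NeZero Lc] (j : ℕ) :
    comp (axEc (ctr (d + 1) Lc) Lc) (coDressKAt (ctr (d + 1) Lc) Lc (Gsym (d := d) Lc j)) = coDressKAt (ctr (d + 1) Lc) Lc (Gsym (d := d) Lc j) ∧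
      comp (coDressKAt (ctr (d + 1) Lc) Lc (Gsym (d := d) Lc j)) (axEc (ctr (d + 1) Lc) Lc) = coDressKAt (ctr (d + 1) Lc) Lc (Gsym (d := d) Lc j) :=
  ⟨comp_axEc_coDressKAt (one_le_of_neZero Lc) (ctrOff_mem_box (one_le_of_neZero Lc)) (spr_Gsym j)
      (fun x hx z m b => Gsym_inr_row_coarse j x z m b hx),
    comp_coDressKAt_axEc (one_le_of_neZero Lc) (ctrOff_mem_box (one_le_of_neZero Lc)) (spr_Gsym j)
      (fun z hz x a m => Gsym_inr_col_coarse j x z a m hz)⟩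

end Rules

/-! ## §4 The IDENTITY pair (K5 of an3's P2 script): `axEc ∘ Πᵀ_ρ-matrix = axEc = Π̂_ρ ∘ axEc` -/

section Identity

/-- [folklore] **THE INTEGER INDICATOR OF A NON-COMB BOND IS IN THE ROOTED AXIAL GAUGE** (in-block root; the `ℤ`-valued twin of
`BorderedHessian.axialGaugeAt_delta1_of_not_isCombBond`, same proof over `isCombBondAt_of_mem_axial`). -/
theorem axialGaugeAt_bondInd_of_not_isCombBond {N : ℕ} (hN : 1 ≤ N) {r : Fin (d + 1) → ℕ} (hr : r ∈ box (d + 1) N) {α : Fin (d + 1)}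
    {x : Fin (d + 1) → ℤ} (hc : ¬ IsCombBondAt (toSite r) N α x) : AxialGaugeAt (toSite r) (bondInd α x) N := by
  intro y b hb
  refine List.sum_eq_zero fun a ha => ?_
  obtain ⟨κ, z', e, hcomb⟩ := isCombBondAt_of_mem_axial hN hr hb y ha
  have h0 : bondInd α x κ z' = 0 := by
    rw [bondInd_apply, if_neg]
    rintro ⟨rfl, rfl⟩
    exact hc hcomb
  rcases e with e | e
  · rw [e, h0]
  · rw [e, h0, neg_zero]

/-- [folklore] **`Π_root` FIXES THE INDICATOR OF A NON-COMB BOND**: `pm (toSite r) N β p α x = [β = α ∧ p = x]` (in-block root;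
`RootedComb.axProjAt_eq_self_of_axialGaugeAt` over `ℤ`). -/
theorem pm_of_not_isCombBond {N : ℕ} (hN : 1 ≤ N) {r : Fin (d + 1) → ℕ} (hr : r ∈ box (d + 1) N) {α : Fin (d + 1)}
    {x : Fin (d + 1) → ℤ} (hc : ¬ IsCombBondAt (toSite r) N α x) (β : Fin (d + 1)) (p : Fin (d + 1) → ℤ) :
    pm (toSite r) N β p α x = if β = α ∧ p = x then 1 else 0 := by
  rw [pm_eq, axProjAt_eq_self_of_axialGaugeAt hN (axialGaugeAt_bondInd_of_not_isCombBond hN hr hc), bondInd_apply]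

open Classical in
/-- [folklore] **`axEc ∘ Πᵀ_ρ-matrix = axEc`**: `comp (axEc (toSite r) N) (piK (toSite r) N) = axEc (toSite r) N` — on the non-comb rows `Π_root` acts
as the identity, comb rows and non-coarse multiplier rows are killed on both sides (in-block root; rooted twin of `RelInvBorderedHessian.comp_axEc_piKBmC`). -/
theorem comp_axEc_piK {N : ℕ} (hN : 1 ≤ N) {r : Fin (d + 1) → ℕ} (hr : r ∈ box (d + 1) N) :
    comp (axEc (toSite r) N) (piK (toSite r) N) = axEc (d := d) (toSite r) N := by
  funext x x' a b
  rw [comp_axEc_apply]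
  rcases a with α | m
  · dsimp only
    rcases b with β | m'
    · rw [piK_inl_inl, axEc_inl_inl]
      by_cases hc : IsCombBondAt (toSite r) N α x
      · rw [if_pos hc, if_neg (fun h => h.2.2 hc)]
      · rw [if_neg hc]
        by_cases hx : x = x' ∧ α = β
        · obtain ⟨rfl, rfl⟩ := hx
          rw [sub_self, if_pos (zero_mem_cube N), pm_of_not_isCombBond hN hr hc, if_pos ⟨rfl, rfl⟩, if_pos ⟨rfl, rfl, hc⟩, Int.cast_one]
        · have hR : ¬ (x = x' ∧ α = β ∧ ¬ IsCombBondAt (toSite r) N α x) := fun h => hx ⟨h.1, h.2.1⟩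
          have hL : ¬ (β = α ∧ x' = x) := fun h => hx ⟨h.2.symm, h.1.symm⟩
          rw [if_neg hR]
          split_ifs with hw
          · rw [pm_of_not_isCombBond hN hr hc, if_neg hL, Int.cast_zero]
          · rfl
    · rw [piK_inl_inr, axEc_inl_inr, ite_self]
  · dsimp only
    rcases b with β | m'
    · rw [piK_inr_inl, axEc_inr_inl, ite_self]
    · rw [piK_inr_inr, axEc_inr_inr]
      by_cases hx : Torus.proj N x = 0
      · rw [if_pos hx]
        by_cases h : x = x' ∧ m = m'
        · rw [if_pos h, if_pos ⟨h.1, h.2, hx⟩]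
        · rw [if_neg h, if_neg (fun h' => h ⟨h'.1, h'.2.1⟩)]
      · rw [if_neg hx, if_neg (fun h => hx h.2.2)]

/-- [folklore] **`Π̂_ρ ∘ axEc = axEc`**: `comp (trK (piK (toSite r) N)) (axEc (toSite r) N) = axEc (toSite r) N` (transpose of `comp_axEc_piK`, `axEc`
symmetric) — K5 of an3's P2 script: the range of the coarse comb slice is fixed by the rooted dressing. -/
theorem comp_trK_piK_axEc {N : ℕ} (hN : 1 ≤ N) {r : Fin (d + 1) → ℕ} (hr : r ∈ box (d + 1) N) :
    comp (trK (piK (toSite r) N)) (axEc (toSite r) N) = axEc (d := d) (toSite r) N := by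
  conv_lhs => rw [← trK_axEc (toSite r) N]
  rw [← trK_comp, comp_axEc_piK hN hr, trK_axEc]

/-- [folklore] The identity pair at the centred root of the comb chart: `axEc ρ_c Lc ∘ piK ρ_c Lc = axEc ρ_c Lc = trK (piK ρ_c Lc) ∘ axEc ρ_c Lc`. -/
theorem axEc_identity_pair_ctr (Lc : ℕ) [NeZero Lc] :
    comp (axEc (ctr (d + 1) Lc) Lc) (piK (ctr (d + 1) Lc) Lc) = axEc (d := d) (ctr (d + 1) Lc) Lc ∧
      comp (trK (piK (ctr (d + 1) Lc) Lc)) (axEc (ctr (d + 1) Lc) Lc) = axEc (d := d) (ctr (d + 1) Lc) Lc :=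
  ⟨comp_axEc_piK (one_le_of_neZero Lc) (ctrOff_mem_box (one_le_of_neZero Lc)),
    comp_trK_piK_axEc (one_le_of_neZero Lc) (ctrOff_mem_box (one_le_of_neZero Lc))⟩

end Identity

end Summit.QuantumFields.BalabanUV.Beta.CombChartResolventRules

end
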